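import Summits.ResolutionOfSingularities.ResolutionOfSingularities.Theorems.FrobeniusClosingPatchingRelPerfectDepthParamLiftPolynomial
import Literature.AlgebraicGeometry.Resolution.BlowupChartSNCLocal
import Mathlib.RingTheory.Localization.Algebra
import HarnessLib

/-!
# Crux `PatchingRelPerfect` (stmt-ResolutionOfSingularities-16161), chain W5.2 — F7(β) d = 2 (β-AX), X2a module 2 (M2c), e-chart algebra II′:
# PARAM-LIFT data for «adjoin one variable and localise», localisation-flexible form

[OURS · L1 W5.2 · F7(β) (β-AX) X-side · res-D-pv-034 AS res-L1-s36-pv-3 per res-L1-w52-plan-1 RULING G11-21 ((M2c) PARAM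
PROPAGATION, e-chart half; blueprint `D/res-D-pv-034/M2C-ECHART-BLUEPRINT.md` step E3).]  Replaces the role of NO printed item;
NOT a statement of the manuscript under review; fact-free, def-free.  AI-written; AI review is weaker than expert review.

ALGEBRA II (`…DepthParamLiftPolynomial`, p555454) gives PARAM-LIFT data for `R → R[X]_p` with `R` regular local and `p` over `𝔪_R`,
for Mathlib's `Localization.AtPrime p`.  The e-chart consumes it in the following shape: `R` is a localisation of a ring `R₀` at a
prime `𝔭` (the coefficient chart `(A/𝔞)[T̂]`), and the target `T` is ANY localisation of `R₀[X]` at a prime `𝔔` over `𝔭`; the map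
`f : R → T` is the one compatible with `C`.  This file PROVES that shape from ALGEBRA II by the two-step localisation
`T ≅ (R[X])_{𝔔 R[X]}` (tree `exists_algEquiv_localization_atPrime_map`, Mathlib `Polynomial.isLocalization`) and the ring transport
`exists_finset_sup_span_eq_maximalIdeal_of_ringEquiv`.

* **`exists_finset_sup_span_eq_maximalIdeal_polynomial_isLocalization`**.

## References
* H. Matsumura, *Commutative Ring Theory* (1986), Thm. 23.7. [Matsumura1987]
-/

-- `Summit.<Summit>.<Sub>.Theorems` with `Sub = Summit` (single-conjunct summit, D-0017)
set_option linter.dupNamespace false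

noncomputable section

open IsLocalRing Polynomial
open Literature.AlgebraicGeometry.Resolution

namespace Summit.ResolutionOfSingularities.ResolutionOfSingularities.Theorems.DepthMultiHost

universe u

/-- [OURS · L1 W5.2 · F7(β) (β-AX) M2c, ALGEBRA II′] **PARAM-LIFT data for `R = (R₀)_𝔭 → T = (R₀[X])_𝔔`, `𝔔 ∩ R₀ = 𝔭`, `R` regular
local**, `T` any localisation at `𝔔` and `f` the map compatible with `C`. [cite: Matsumura1987, Thm. 23.7] -/
theorem exists_finset_sup_span_eq_maximalIdeal_polynomial_isLocalization {R₀ : Type u} [CommRing R₀] (𝔭 : Ideal R₀)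
    [𝔭.IsPrime] {R : Type u} [CommRing R] [Algebra R₀ R] [IsLocalization.AtPrime R 𝔭] [IsRegularLocalRing R]
    (𝔔 : Ideal R₀[X]) [𝔔.IsPrime] (h𝔔 : 𝔔.comap C = 𝔭)
    {T : Type u} [CommRing T] [Algebra R₀[X] T] [IsLocalization.AtPrime T 𝔔] [IsLocalRing T]
    (f : R →+* T) (hf : f.comp (algebraMap R₀ R) = (algebraMap R₀[X] T).comp C) :
    ∃ s : Finset T, (maximalIdeal R).map f ⊔ Ideal.span (s : Set T) = maximalIdeal T ∧
      s.card + (maximalIdeal R).spanFinrank = (maximalIdeal T).spanFinrank := by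
  classical
  letI : Algebra R₀[X] R[X] := Polynomial.algebra R₀ R
  haveI : IsLocalization (𝔭.primeCompl.map (C : R₀ →+* R₀[X])) R[X] := Polynomial.isLocalization 𝔭.primeCompl R
  -- the submonoid misses `𝔔`
  have hdisj : Disjoint ((𝔭.primeCompl.map (C : R₀ →+* R₀[X]) : Submonoid R₀[X]) : Set R₀[X]) (𝔔 : Set R₀[X]) := by
    refine Set.disjoint_left.mpr ?_
    rintro _ ⟨r, hr, rfl⟩ hq
    exact hr (by rw [← h𝔔]; exact Ideal.mem_comap.mpr hq)
  -- two-step localisation: `T ≅ (R[X])_{𝔔₁}`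
  obtain ⟨𝔔₁, h𝔔₁, h𝔔₁c, ⟨e⟩⟩ :=
    exists_algEquiv_localization_atPrime_map (T₀ := R₀[X]) (T₁ := R[X]) (Sb := T) 𝔔
      (𝔭.primeCompl.map (C : R₀ →+* R₀[X])) hdisj
  -- `𝔔₁ ∩ R = 𝔪_R`
  have halgR : ∀ r : R₀, algebraMap R₀[X] R[X] (C r) = C (algebraMap R₀ R r) := fun r => by
    rw [Polynomial.algebraMap_def, Polynomial.coe_mapRingHom, Polynomial.map_C]
  have h𝔔₁R : 𝔔₁.asIdeal.comap (C : R →+* R[X]) = maximalIdeal R := by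
    refine ((IsLocalRing.maximalIdeal.isMaximal R).eq_of_le (Ideal.IsPrime.ne_top inferInstance) ?_).symm
    rw [← IsLocalization.AtPrime.map_eq_maximalIdeal 𝔭 R, Ideal.map_le_iff_le_comap]
    intro r hr
    rw [Ideal.mem_comap, Ideal.mem_comap, ← halgR, h𝔔₁]
    exact Ideal.mem_map_of_mem _ (by rw [← h𝔔] at hr; exact Ideal.mem_comap.mp hr)
  -- ALGEBRA II for `(R[X])_{𝔔₁}`
  obtain ⟨s, hs1, hs2⟩ := exists_finset_sup_span_eq_maximalIdeal_polynomial 𝔔₁.asIdeal h𝔔₁R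
  -- transport along `e.symm`
  have hfe : ∀ r : R, e.symm ((algebraMap R[X] (Localization.AtPrime 𝔔₁.asIdeal)).comp C r) = f r := by
    -- both sides are ring maps `R → T` agreeing on `R₀`
    suffices h : (e.symm.toRingEquiv.toRingHom.comp ((algebraMap R[X] (Localization.AtPrime 𝔔₁.asIdeal)).comp C)) = f from
      fun r => RingHom.congr_fun h r
    refine IsLocalization.ringHom_ext 𝔭.primeCompl ?_
    rw [hf, RingHom.comp_assoc, RingHom.comp_assoc]
    ext r
    change e.symm (algebraMap R[X] _ (C (algebraMap R₀ R r))) = algebraMap R₀[X] T (C r)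
    rw [← halgR, ← IsScalarTower.algebraMap_apply R₀[X] R[X] (Localization.AtPrime 𝔔₁.asIdeal)]
    exact e.symm.commutes (C r)
  exact exists_finset_sup_span_eq_maximalIdeal_of_ringEquiv ((algebraMap R[X] (Localization.AtPrime 𝔔₁.asIdeal)).comp C) f
    (RingEquiv.refl R) e.symm.toRingEquiv (fun r => by rw [RingEquiv.refl_apply]; exact hfe r) ⟨s, hs1, hs2⟩

end Summit.ResolutionOfSingularities.ResolutionOfSingularities.Theorems.DepthMultiHost

end
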